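import Mathlib
import HarnessLib

/-!
# Route `RadicialJung`, crux `CleanModels` (stmt-ResolutionOfSingularities-15917), line `Sketch` rev 35, stub 6 `stub_cleanProp44` (X44c),
# `τ = 1` residual, births: NO BIRTH AT A CLOSED POINT OF DEGREE `> deg F / p` (the small-`δ` corner of (B5″))

Seat decomp-res-hand-2 g13 (structural hand), a brick after ✓ `…BirthDescent.lean` / `…BirthCorner.lean` / `…BirthCornerSeparable.lean` /
`…BirthDerivation.lean` / `…BirthCornerCount.lean` (hand-2 g12).  Dictionary (memo `Cruxes/CleanModels/Lines/Sketch-memo-4e-cleanPermissible.md`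
§2.5–2.6): a birth `c`, its successor `Γ'' ≅ ℙ¹_{κ(c)}` with affine coordinate `u`, the restriction `F := U|_{Γ''} ∈ κ(c)[u]` of the unit
presentation with `deg F ≤ δ`, a closed point `c' ↔` a monic irreducible `π ∈ κ(c)[u]`, and `ν(c') := sup_G ord_π (F − G^p)`; `c'` is a birth iff
`2 ≤ ν(c') < ∞`, and the restriction argument gives `δ*(c') ≤ ν(c')`.

THE BRICK (pure polynomial algebra over any field of characteristic `p`, no separability, no irreducibility):

* `births_pow_dvd_pow_sub_modByMonic_pow` — `π^p ∣ G^p − (G mod π)^p` (Frobenius is additive: `G = π·Q + R ⟹ G^p = π^p Q^p + R^p`).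
* `births_eq_modByMonic_pow_of_pow_dvd` — **if `π^p ∣ F − G^p` and `deg F < p · deg π` then `F = (G mod π)^p`**: both `F` and `(G mod π)^p` have
  degree `< deg π^p`, and their difference is divisible by `π^p`.
* `births_exists_eq_pow_of_pow_dvd` / `births_not_pow_dvd_of_forall_ne_pow` — hence `F ∈ κ[u]^p`; contrapositively, **if `F` is not a `p`-th
  power in `κ(c)[u]` then `ν(c') < p` at EVERY closed point `c'` with `p · [κ(c') : κ(c)] > deg F`** (`births_not_pow_dvd_of_le` for exponents `n ≥ p`).
* `births_not_sq_dvd_of_natDegree_le_two` — the instance `p = 2`, `deg F ≤ 2`, `deg π = 2`: `π² ∤ F − G²`.  This is hand-2 g12's caveat (iii) of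
  (B5″) («small cases `δ ≤ 2`: only `p = 2, δ = 2` … the inseparable quadratic computation `π = u² + a`: `π² ∣ F − G² ⟹ F ∈ κ[u]²»), now for EVERY
  quadratic point, separable or not: together with ✓ `births_corner_unique` (≤ 1 rational non-descending birth) the case `δ = 2` of the corner
  carries no birth at a non-rational point at all.
* `births_not_pow_dvd_X_sub_C_of_natDegree_lt` — the rational instance: `deg F < p ⟹ (u − α)^p ∤ F − G^p`, i.e. `ν(c') ≤ p − 1` at rational
  points when `δ < p` (consistent with «births need `δ ∈ pℤ_{≥ p}`»).

Honest framing: OURS, elementary; nothing here proves (B5″), the hypotheses of ✓ `cleanProp44_of_tauOneResidual`, X44c, any case of `CleanModels`,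
or resolution of singularities in characteristic `p`.  Setting only: [cite: CossartPiltant2008, Prop. 4.4] [cite: CossartJannsenSaito2020, Thm. 4.22].
-/

set_option linter.dupNamespace false -- mandated namespace of this single-conjunct summit

open Polynomial

namespace Summit.ResolutionOfSingularities.ResolutionOfSingularities.Theorems.RadicialJung.CleanModels

/-! ## §1 Frobenius and division with remainder -/

/-- **`π^p ∣ G^p − (G mod π)^p`** over a commutative ring of prime characteristic `p`: from `G = (G mod π) + π · (G div π)` (Mathlib's
`modByMonic_add_div`, valid for every `π`) and the additivity of Frobenius. [folklore] -/
theorem births_pow_dvd_pow_sub_modByMonic_pow {K : Type*} [CommRing K] (p : ℕ) [Fact p.Prime] [CharP K p]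
    (π G : K[X]) : π ^ p ∣ G ^ p - (G %ₘ π) ^ p := by
  have hG : G = G %ₘ π + π * (G /ₘ π) := (modByMonic_add_div G π).symm
  have key : G ^ p = (G %ₘ π) ^ p + π ^ p * (G /ₘ π) ^ p := by
    conv_lhs => rw [hG]
    rw [add_pow_char, mul_pow]
  refine ⟨(G /ₘ π) ^ p, ?_⟩
  rw [key]
  ring

/-- **THE SMALL-DEGREE LEMMA.**  Over a field of characteristic `p`, `π` monic: if `π^p ∣ F − G^p` and `deg F < p · deg π`, then
`F = (G mod π)^p` — in particular `F` is a `p`-th power in `K[u]`.  (Both sides have degree `< deg π^p` and `π^p` divides their difference.)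
[folklore] -/
theorem births_eq_modByMonic_pow_of_pow_dvd {K : Type*} [Field K] (p : ℕ) [Fact p.Prime] [CharP K p]
    {π F G : K[X]} (hπ : π.Monic) (hdvd : π ^ p ∣ F - G ^ p) (hdeg : F.natDegree < p * π.natDegree) :
    F = (G %ₘ π) ^ p := by
  have hp : 0 < p := (Fact.out : p.Prime).pos
  have hπ1 : π ≠ 1 := by
    rintro rfl
    simp at hdeg
  -- `π^p ∣ F − (G mod π)^p`
  have hdvd' : π ^ p ∣ F - (G %ₘ π) ^ p := by
    have := dvd_add hdvd (births_pow_dvd_pow_sub_modByMonic_pow p π G)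
    simpa using this
  -- degrees
  have hR : ((G %ₘ π) ^ p).natDegree < p * π.natDegree := by
    calc ((G %ₘ π) ^ p).natDegree ≤ p * (G %ₘ π).natDegree := natDegree_pow_le
      _ < p * π.natDegree := Nat.mul_lt_mul_of_pos_left (natDegree_modByMonic_lt G hπ hπ1) hp
  have hππ : (π ^ p).natDegree = p * π.natDegree := natDegree_pow π p
  have hlt : (F - (G %ₘ π) ^ p).natDegree < (π ^ p).natDegree := by
    rw [hππ]
    exact lt_of_le_of_lt (natDegree_sub_le _ _) (max_lt hdeg hR)
  have h0 : F - (G %ₘ π) ^ p = 0 := eq_zero_of_dvd_of_natDegree_lt hdvd' hlt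
  exact sub_eq_zero.mp h0

/-- The same with an `∃`: `π^p ∣ F − G^p`, `deg F < p · deg π` ⟹ `F = H^p` for some `H` with `deg H < deg π` (for `deg π ≥ 1`). [folklore] -/
theorem births_exists_eq_pow_of_pow_dvd {K : Type*} [Field K] (p : ℕ) [Fact p.Prime] [CharP K p]
    {π F G : K[X]} (hπ : π.Monic) (hπ1 : π ≠ 1) (hdvd : π ^ p ∣ F - G ^ p) (hdeg : F.natDegree < p * π.natDegree) :
    ∃ H : K[X], H.natDegree < π.natDegree ∧ F = H ^ p :=
  ⟨G %ₘ π, natDegree_modByMonic_lt G hπ hπ1, births_eq_modByMonic_pow_of_pow_dvd p hπ hdvd hdeg⟩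

/-! ## §2 No birth at a closed point of large degree -/

/-- **`ν(c') < p` at every closed point `c'` with `p · deg π > deg F`, when `F ∉ K[u]^p`**: for such `π` (monic) and every `G`,
`π^p ∤ F − G^p`. [folklore] -/
theorem births_not_pow_dvd_of_forall_ne_pow {K : Type*} [Field K] (p : ℕ) [Fact p.Prime] [CharP K p]
    {π F : K[X]} (hπ : π.Monic) (hnot : ∀ H : K[X], F ≠ H ^ p) (hdeg : F.natDegree < p * π.natDegree) (G : K[X]) :
    ¬ π ^ p ∣ F - G ^ p :=
  fun h => hnot (G %ₘ π) (births_eq_modByMonic_pow_of_pow_dvd p hπ h hdeg)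

/-- The same for every exponent `n ≥ p`: `π^n ∤ F − G^p`. [folklore] -/
theorem births_not_pow_dvd_of_le {K : Type*} [Field K] (p : ℕ) [Fact p.Prime] [CharP K p]
    {π F : K[X]} (hπ : π.Monic) (hnot : ∀ H : K[X], F ≠ H ^ p) (hdeg : F.natDegree < p * π.natDegree) {n : ℕ} (hn : p ≤ n)
    (G : K[X]) : ¬ π ^ n ∣ F - G ^ p :=
  fun h => births_not_pow_dvd_of_forall_ne_pow p hπ hnot hdeg G ((pow_dvd_pow π hn).trans h)

/-- In the `δ`-language of the memo: `deg F ≤ δ` and `δ < p · deg π` give `π^n ∤ F − G^p` for all `n ≥ p` — a closed point of degree `> δ / p`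
over `κ(c)` has `ν < p`, so it is never a non-descending birth of a chain with `δ* ≥ p`. [folklore] -/
theorem births_not_pow_dvd_of_natDegree_le {K : Type*} [Field K] (p : ℕ) [Fact p.Prime] [CharP K p]
    {π F : K[X]} (hπ : π.Monic) (hnot : ∀ H : K[X], F ≠ H ^ p) {δ : ℕ} (hF : F.natDegree ≤ δ) (hδ : δ < p * π.natDegree)
    {n : ℕ} (hn : p ≤ n) (G : K[X]) : ¬ π ^ n ∣ F - G ^ p :=
  births_not_pow_dvd_of_le p hπ hnot (lt_of_le_of_lt hF hδ) hn G

/-! ## §3 The two instances used by (B5″) -/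

/-- **The case `p = 2`, `δ = 2` at a QUADRATIC point (separable or inseparable):** `deg F ≤ 2`, `π` monic of degree `2`, `F ∉ K[u]²` ⟹
`π² ∤ F − G²` for every `G` — hand-2 g12's caveat (iii) of (B5″), for every quadratic `π` (the inseparable `π = u² + a` included). [folklore] -/
theorem births_not_sq_dvd_of_natDegree_le_two {K : Type*} [Field K] [CharP K 2]
    {π F : K[X]} (hπ : π.Monic) (hπ2 : π.natDegree = 2) (hnot : ∀ H : K[X], F ≠ H ^ 2) (hF : F.natDegree ≤ 2) (G : K[X]) :
    ¬ π ^ 2 ∣ F - G ^ 2 :=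
  haveI : Fact (Nat.Prime 2) := ⟨Nat.prime_two⟩
  births_not_pow_dvd_of_natDegree_le 2 hπ hnot hF (by rw [hπ2]; norm_num) le_rfl G

/-- **The rational instance:** `deg F < p` and `F ∉ K[u]^p` ⟹ `(u − α)^p ∤ F − G^p` for every `α ∈ K` and every `G` — at a `κ(c)`-rational
point `ν(c') ≤ p − 1` whenever `δ < p`. [folklore] -/
theorem births_not_pow_dvd_X_sub_C_of_natDegree_lt {K : Type*} [Field K] (p : ℕ) [Fact p.Prime] [CharP K p]
    {F : K[X]} (hnot : ∀ H : K[X], F ≠ H ^ p) (hF : F.natDegree < p) (α : K) (G : K[X]) :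
    ¬ (X - C α) ^ p ∣ F - G ^ p :=
  births_not_pow_dvd_of_forall_ne_pow p (monic_X_sub_C α) hnot (by rw [natDegree_X_sub_C, mul_one]; exact hF) G

/-- **Equivalently, as a bound on the contact order:** if `π^n ∣ F − G^p` with `π` monic, `F ∉ K[u]^p` and `deg F < p · deg π`, then `n < p`
(`ν(c') ≤ p − 1`). [folklore] -/
theorem births_lt_of_pow_dvd_of_natDegree_lt {K : Type*} [Field K] (p : ℕ) [Fact p.Prime] [CharP K p]
    {π F G : K[X]} (hπ : π.Monic) (hnot : ∀ H : K[X], F ≠ H ^ p) (hdeg : F.natDegree < p * π.natDegree) {n : ℕ}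
    (h : π ^ n ∣ F - G ^ p) : n < p := by
  by_contra hn
  exact births_not_pow_dvd_of_le p hπ hnot hdeg (not_lt.mp hn) G h

end Summit.ResolutionOfSingularities.ResolutionOfSingularities.Theorems.RadicialJung.CleanModels
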